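import Mathlib
import HarnessLib

/-!
# Route `ExtremiserTransience`, LINE g5-α' (seat ns-idea-5): the LOG-TIME BOOKKEEPING LEMMA behind S1
# (`stub_plateauScalesFixed`, item 27822 `PlateauSliceTransfer`) — near-extremal times at which enstrophy grows

`--supports stmt-NavierStokesRegularity-27822`.  Pure real analysis (no Navier–Stokes): the measure-theoretic heart of
Step 1 + Step 2 of the S1 plan (`LINE-CARD-27822-v3.md` §S1-PLAN, attached on 27822).

Along a Type-I singular flow write `e(t) ∈ [0, κ]` for the stretching efficiency (the canonical depletion coefficient,
`DepletionLadder.exists_canonical_coefficient`) and `g(t) ≤ G` for the normalised enstrophy growth rate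
`[λ(e−λ)]₊` (`d log‖ω‖₂² / d log(1/(T−t)) ≤ 2C²·g`).  Failure of the per-flow certificate says that for every `θ < 1`
and every `B` the log-time quadratic mean of `e` exceeds `θκ` on some window `[t₁,t)`:
`θ²κ² log((T−t₁)/(T−t)) + B < ∫_{t₁}^t e²/(T−τ)` (`hfail`); blow-up of the enstrophy at Leray's rate against the Type-I
Grönwall says `a·log((T−t₁)/(T−t)) − b ≤ ∫_{t₁}^t g/(T−τ)` on every window (`hgrowth`).  CONCLUSION
(`exists_nearExtremal_growthTime`): for every `ε > 0` there is a time `τ ∈ [t₁,T)` which is simultaneously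
NEAR-EXTREMAL (`κ − ε ≤ e τ`) and GROWING (`a/4 ≤ g τ`).  In the S1 plan `a/4 ≤ λ(e−λ)` pins the dissipation length
`ℓ = ‖ω‖₂/‖∇ω‖₂` to the Type-I length (`Mℓ/ν ∈ [1/κ, 4κ/a]`): thin near-plateaus cannot carry the blow-up.

Proof: if every near-extremal time of the window had `g < a/4`, then pointwise on the window
`g ≤ a/4 + (G/(εκ))·(κ² − e²)` (on `{e < κ−ε}` the bracket is `≥ εκ`), and integrating against `dτ/(T−τ)` gives
`aL − b ≤ ∫g/(T−τ) ≤ (a/4)L + (G/(εκ))(κ²L − ∫e²/(T−τ)) < (a/4)L + (G/(εκ))((1−θ²)κ²L − B)`; with `1 − θ² = s`,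
`s = aε/(2Gκ + 2aε)` (so `Gκs/ε ≤ a/2`) this reads `(a/4)L < b`, while `hfail` itself forces `L > B/(sκ²)`, and
`B = sκ²(max(4b/a,0) + 1)` makes `L > 4b/a` — contradiction.  HONEST FRAMING: a lemma about two real functions on an
interval; nothing about Navier–Stokes is proved here, and no summit is proved by a line. [folklore]
-/

noncomputable section

open Set MeasureTheory intervalIntegral

namespace Summit.NavierStokesRegularity.NavierStokesRegularity.Theorems.ExtremiserTransience

/-- A measurable function bounded in absolute value by `M` divided by `T − τ` is interval-integrable on `[a, b]`
when `a ≤ b < T`. [folklore] -/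
theorem intervalIntegrable_div_sub_of_bounded {f : ℝ → ℝ} {T a b M : ℝ} (hfm : Measurable f)
    (hf : ∀ τ, |f τ| ≤ M) (hab : a ≤ b) (hbT : b < T) :
    IntervalIntegrable (fun τ => f τ / (T - τ)) volume a b := by
  rw [intervalIntegrable_iff_integrableOn_Ioc_of_le hab]
  have hmeas : Measurable fun τ => f τ / (T - τ) := hfm.div (measurable_const.sub measurable_id)
  have hM : 0 ≤ M := le_trans (abs_nonneg _) (hf a)
  refine IntegrableOn.of_bound (measure_Ioc_lt_top) hmeas.aestronglyMeasurable (M / (T - b)) ?_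
  refine (ae_restrict_mem measurableSet_Ioc).mono fun s hs => ?_
  have hTs : 0 < T - s := by linarith [hs.2]
  rw [Real.norm_eq_abs, abs_div, abs_of_pos hTs]
  calc |f s| / (T - s) ≤ M / (T - s) := div_le_div_of_nonneg_right (hf s) hTs.le
    _ ≤ M / (T - b) := div_le_div_of_nonneg_left hM (by linarith) (by linarith [hs.2])

/-- `∫_{t₁}^{t} dτ/(T−τ) = log((T−t₁)/(T−t))` for `t₁ ≤ t < T`. [folklore] -/
theorem integral_one_div_sub_window {T t₁ t : ℝ} (ht₁t : t₁ ≤ t) (ht : t < T) :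
    ∫ τ in t₁..t, 1 / (T - τ) = Real.log ((T - t₁) / (T - t)) := by
  rw [intervalIntegral.integral_comp_sub_left (fun σ : ℝ => 1 / σ) (a := t₁) (b := t) T]
  exact integral_one_div_of_pos (by linarith) (by linarith)

set_option maxHeartbeats 800000 in
/-- **Log-time bookkeeping** (LINE g5-α', S1 Steps 1–2): a window on which the quadratic log-mean of `e ≤ κ` is
`> θκ` for `θ` close to `1` with a large surplus `B`, and on which `∫ g/(T−τ) ≥ a·L − b`, contains a time that is
both near-extremal for `e` and has `g ≥ a/4`. [folklore] -/
theorem exists_nearExtremal_growthTime {T t₁ κ ε G a b : ℝ} (hκ : 0 < κ) (hε : 0 < ε)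
    (hG : 0 ≤ G) (ha : 0 < a) {e g : ℝ → ℝ} (hem : Measurable e) (hgm : Measurable g)
    (he : ∀ τ, 0 ≤ e τ ∧ e τ ≤ κ) (hg : ∀ τ, |g τ| ≤ G)
    (hfail : ∀ θ : ℝ, 0 ≤ θ → θ < 1 → ∀ B : ℝ, ∃ t ∈ Set.Ico t₁ T,
      θ ^ 2 * κ ^ 2 * Real.log ((T - t₁) / (T - t)) + B < ∫ τ in t₁..t, e τ ^ 2 / (T - τ))
    (hgrowth : ∀ t ∈ Set.Ico t₁ T,
      a * Real.log ((T - t₁) / (T - t)) - b ≤ ∫ τ in t₁..t, g τ / (T - τ)) :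
    ∃ τ ∈ Set.Ico t₁ T, κ - ε ≤ e τ ∧ a / 4 ≤ g τ := by
  by_contra H
  push Not at H
  -- the parameters
  set s : ℝ := a * ε / (2 * G * κ + 2 * a * ε) with hs_def
  have hden : 0 < 2 * G * κ + 2 * a * ε := by positivity
  have hs0 : 0 < s := div_pos (by positivity) hden
  have hs1 : s ≤ 1 / 2 := by
    rw [hs_def, div_le_iff₀ hden]
    nlinarith [mul_nonneg hG hκ.le, mul_pos ha hε]
  have hsG : G / (ε * κ) * (s * κ ^ 2) ≤ a / 2 := by
    have hεκ0 : 0 < ε * κ := by positivity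
    rw [hs_def]
    rw [show G / (ε * κ) * (a * ε / (2 * G * κ + 2 * a * ε) * κ ^ 2) =
        G * κ * a / (2 * G * κ + 2 * a * ε) by field_simp]
    rw [div_le_iff₀ hden]
    nlinarith [mul_nonneg hG hκ.le, mul_pos ha hε, mul_pos (mul_pos ha ha) hε]
  set θ : ℝ := Real.sqrt (1 - s) with hθ_def
  have hθ0 : 0 ≤ θ := Real.sqrt_nonneg _
  have hθ1 : θ < 1 := by
    rw [hθ_def, Real.sqrt_lt' one_pos]
    linarith
  have hθsq : θ ^ 2 = 1 - s := by
    rw [hθ_def, Real.sq_sqrt (by linarith)]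
  set B : ℝ := s * κ ^ 2 * (max (4 * b / a) 0 + 1) with hB_def
  have hB0 : 0 ≤ B := by positivity
  obtain ⟨t, ht, hlt⟩ := hfail θ hθ0 hθ1 B
  have ht₁t : t₁ ≤ t := ht.1
  have htT : t < T := ht.2
  set L : ℝ := Real.log ((T - t₁) / (T - t)) with hL_def
  have hL : ∫ τ in t₁..t, 1 / (T - τ) = L := integral_one_div_sub_window ht₁t htT
  -- interval integrability of the three weights
  have hIw : IntervalIntegrable (fun τ => (1 : ℝ) / (T - τ)) volume t₁ t :=
    intervalIntegrable_div_sub_of_bounded (f := fun _ => (1 : ℝ)) (M := 1) measurable_const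
      (fun _ => by simp) ht₁t htT
  have hIe : IntervalIntegrable (fun τ => e τ ^ 2 / (T - τ)) volume t₁ t :=
    intervalIntegrable_div_sub_of_bounded (M := κ ^ 2) (hem.pow_const 2)
      (fun τ => by
        rw [abs_of_nonneg (sq_nonneg _)]
        exact pow_le_pow_left₀ (he τ).1 (he τ).2 2) ht₁t htT
  have hIg : IntervalIntegrable (fun τ => g τ / (T - τ)) volume t₁ t :=
    intervalIntegrable_div_sub_of_bounded (M := G) hgm hg ht₁t htT
  -- (1) the mean of `e²` is at most `κ²`: `∫ e²/(T−τ) ≤ κ² L`, hence `B < s κ² L`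
  have hIe_le : ∫ τ in t₁..t, e τ ^ 2 / (T - τ) ≤ κ ^ 2 * L := by
    have h := intervalIntegral.integral_mono_on ht₁t hIe (hIw.const_mul (κ ^ 2)) fun τ hτ => by
      have hTτ : 0 < T - τ := by linarith [hτ.2]
      show e τ ^ 2 / (T - τ) ≤ κ ^ 2 * (1 / (T - τ))
      rw [mul_one_div]
      exact div_le_div_of_nonneg_right (pow_le_pow_left₀ (he τ).1 (he τ).2 2) hTτ.le
    rw [intervalIntegral.integral_const_mul, hL] at h
    exact h
  have hLB : B < s * κ ^ 2 * L := by nlinarith [hlt, hIe_le, hθsq]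
  have hL4b : 4 * b / a < L := by
    have hsk : 0 < s * κ ^ 2 := by positivity
    have h1 : max (4 * b / a) 0 + 1 < L := by
      by_contra h2
      push Not at h2
      have : s * κ ^ 2 * L ≤ B := by
        rw [hB_def]; exact mul_le_mul_of_nonneg_left h2 hsk.le
      linarith
    linarith [le_max_left (4 * b / a) 0]
  -- (2) the pointwise comparison on the window
  have hpt : ∀ τ ∈ Set.Icc t₁ t,
      g τ / (T - τ) ≤ (a / 4) * (1 / (T - τ)) + G / (ε * κ) * (κ ^ 2 * (1 / (T - τ)) - e τ ^ 2 / (T - τ)) := by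
    intro τ hτ
    have hTτ : 0 < T - τ := by linarith [hτ.2]
    have hεκ0 : 0 < ε * κ := by positivity
    rw [show (a / 4) * (1 / (T - τ)) + G / (ε * κ) * (κ ^ 2 * (1 / (T - τ)) - e τ ^ 2 / (T - τ)) =
        (a / 4 + G / (ε * κ) * (κ ^ 2 - e τ ^ 2)) / (T - τ) by
      field_simp]
    refine div_le_div_of_nonneg_right ?_ hTτ.le
    have hsq : 0 ≤ κ ^ 2 - e τ ^ 2 := by nlinarith [(he τ).1, (he τ).2]
    by_cases hcase : κ - ε ≤ e τ
    · have hgt : g τ < a / 4 := H τ ⟨hτ.1, lt_of_le_of_lt hτ.2 htT⟩ hcase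
      nlinarith [div_nonneg hG hεκ0.le, hsq]
    · push Not at hcase
      have hbig : ε * κ ≤ κ ^ 2 - e τ ^ 2 := by nlinarith [(he τ).1, hcase]
      have h1 : G ≤ G / (ε * κ) * (κ ^ 2 - e τ ^ 2) := by
        calc G = G / (ε * κ) * (ε * κ) := by field_simp
          _ ≤ G / (ε * κ) * (κ ^ 2 - e τ ^ 2) :=
            mul_le_mul_of_nonneg_left hbig (div_nonneg hG hεκ0.le)
      linarith [le_abs_self (g τ), hg τ]
  -- (3) integrate the comparison
  have hIrhs : IntervalIntegrable
      (fun τ => (a / 4) * (1 / (T - τ)) + G / (ε * κ) * (κ ^ 2 * (1 / (T - τ)) - e τ ^ 2 / (T - τ)))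
      volume t₁ t :=
    (hIw.const_mul (a / 4)).add (((hIw.const_mul (κ ^ 2)).sub hIe).const_mul (G / (ε * κ)))
  have hint := intervalIntegral.integral_mono_on ht₁t hIg hIrhs hpt
  have I1 : ∫ τ in t₁..t, (a / 4) * (1 / (T - τ)) = (a / 4) * L := by
    rw [intervalIntegral.integral_const_mul, hL]
  have I2 : ∫ τ in t₁..t, (κ ^ 2 * (1 / (T - τ)) - e τ ^ 2 / (T - τ)) =
      κ ^ 2 * L - ∫ τ in t₁..t, e τ ^ 2 / (T - τ) := by
    rw [intervalIntegral.integral_sub (hIw.const_mul (κ ^ 2)) hIe, intervalIntegral.integral_const_mul, hL]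
  have I3 : ∫ τ in t₁..t, G / (ε * κ) * (κ ^ 2 * (1 / (T - τ)) - e τ ^ 2 / (T - τ)) =
      G / (ε * κ) * (κ ^ 2 * L - ∫ τ in t₁..t, e τ ^ 2 / (T - τ)) := by
    rw [intervalIntegral.integral_const_mul, I2]
  have I : ∫ τ in t₁..t,
      ((a / 4) * (1 / (T - τ)) + G / (ε * κ) * (κ ^ 2 * (1 / (T - τ)) - e τ ^ 2 / (T - τ))) =
      (a / 4) * L + G / (ε * κ) * (κ ^ 2 * L - ∫ τ in t₁..t, e τ ^ 2 / (T - τ)) := by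
    rw [intervalIntegral.integral_add (hIw.const_mul (a / 4))
        (((hIw.const_mul (κ ^ 2)).sub hIe).const_mul (G / (ε * κ))), I1, I3]
  have hgr := hgrowth t ht
  have hchain : a * L - b ≤
      (a / 4) * L + G / (ε * κ) * (κ ^ 2 * L - ∫ τ in t₁..t, e τ ^ 2 / (T - τ)) :=
    hgr.trans (hint.trans I.le)
  -- (4) the contradiction
  have hGεκ : 0 ≤ G / (ε * κ) := div_nonneg hG (by positivity)
  have h2 : G / (ε * κ) * (κ ^ 2 * L - ∫ τ in t₁..t, e τ ^ 2 / (T - τ)) ≤ G / (ε * κ) * (s * κ ^ 2 * L) := by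
    refine mul_le_mul_of_nonneg_left ?_ hGεκ
    nlinarith [hlt, hθsq, hB0]
  have h3 : G / (ε * κ) * (s * κ ^ 2 * L) ≤ a / 2 * L := by
    have hL0 : 0 ≤ L := by
      have : (0 : ℝ) ≤ max (4 * b / a) 0 + 1 := by positivity
      nlinarith [hLB, hB0, mul_pos hs0 (pow_pos hκ 2)]
    calc G / (ε * κ) * (s * κ ^ 2 * L) = (G / (ε * κ) * (s * κ ^ 2)) * L := by ring
      _ ≤ a / 2 * L := mul_le_mul_of_nonneg_right hsG hL0
  have h4 : a / 4 * L ≤ b := by linarith [hchain, h2, h3]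
  have h5 : b < a / 4 * L := by
    have := hL4b
    rw [div_lt_iff₀ ha] at this
    linarith
  linarith

end Summit.NavierStokesRegularity.NavierStokesRegularity.Theorems.ExtremiserTransience

end
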